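import Mathlib
import HarnessLib
import Literature.Analysis.FluidPDE.VorticityCalculus
import Literature.Analysis.FluidPDE.KatoSymmetryCovariance
import Literature.Analysis.FluidPDE.KNSSOseenMildDecayTools
import Summits.NavierStokesRegularity.NavierStokesRegularity.Theorems.LocalSineTubeDoorProfileAlignedWindowRigidityAncient
import Summits.NavierStokesRegularity.NavierStokesRegularity.Theorems.PoloidalWindowDoorLrcModEntireThreadPins

/-!
# Route `PoloidalWindowDoor`, crux `PoloidalWindowRigidity` (stmt-NavierStokesRegularity-19708) — LINE 18 «leaf_uniform» (ns-idea-8 g9; critic idea-crit-7 g6 PASS;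
# DIRECTOR-NS #280/#281 key): the two LOAD-BEARING hot-set pins R9 `HotLapSign` and R10 `HotTimePin`, VERBATIM (Cruxes-local `Pinned`, `hotSet`,
# `hess`, `lapH` unfolded)

Cell ns-regularity-ideate, seat ns-poloidal-K2-p2 g13 (K2 hand).  `Cruxes/PoloidalWindowRigidity/Lines/leaf_uniform.lean` (v1.1, statements unchanged in v1.2) splits the ridge residue C2a′ of
hot_split along the hot vortex LEAF; its kernel `cellC2aRidge_of_leaf` consumes four structure stubs R8–R11, of which R9 (S) and R10 (S/M) are landed here:

* `hotLapSign` (R9 `HotLapSign`): at every hot point `y` (`y 2 = 0`, `v₂(−1,y) = N := v₂(−1,0)`), `N·Δₕv₂(−1,y) ≤ 0`, the horizontal Laplacian spelled in the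
  column's nested-`fderiv` convention `Δₕv₂ = Σ_{i=0,1} D(x ↦ Dv₂(x)eᵢ)(y)eᵢ`.  Every hot point is a GLOBAL extremum of `v₂(−1,·)` (the `Pinned` bound
  `√(−t)|v₂| ≤ |N|` at `t = −1`), so each pure second derivative of `σv₂` is `≤ 0` (`…ThreadPins.deriv2_nonpos_of_isLocalMax` +
  `deriv2_line_eq_iteratedFDeriv`; dictionary `Literature.Analysis.FluidPDE.fderiv_fderiv_apply_eq_iteratedFDeriv`; `C²` from the class analyticity
  `…Ancient.analyticOnNhd_slice`).
* `hotTimePin` (R10 `HotTimePin`): `∂ₜv₂(−1,y) = N/2` at every hot point — the tree's `…ThreadPins.threadTimePin` (Fermat in `t` for `√(−s)σv₂(s,0)`,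
  honest time-differentiability from `analyticOnNhd_uncurry`) applied to the TRANSLATED profile `v(·, · + y)`, which is again in the class with the same
  constant and has its hot spot at `0` (translation covariance of the mild identity: `Literature.Analysis.FluidPDE.heatExtension_comp_add_right`,
  `oseenDuhamel_comp_add_right`).

HONEST LABEL: two S/M structure facts of the hot set; R8 `RidgeInvariant` (M) / R11 `CurtainInvariant` (L) and the research cells `CellFlatLeaf` / `CellMorseLeaf` are NOT
touched; C2a′ / C2b′ / S0 / ⟨27893⟩ OPEN; 19708 / 20428 OPEN; NS regularity NOT proved.
-/

noncomputable section

-- the summit and its single sub-problem share the name (CONVENTIONS §1), as in every Theorems file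
set_option linter.dupNamespace false

namespace Summit.NavierStokesRegularity.NavierStokesRegularity.Theorems.PoloidalWindowDoorPoloidalWindowRigidityLeafUniformPins

open Set Function MeasureTheory Filter Topology Metric
open scoped InnerProductSpace RealInnerProductSpace Laplacian
open Literature.Analysis Literature.Analysis.FluidPDE Literature.Analysis.UnboundedOperators
open Summit.NavierStokesRegularity.NavierStokesRegularity.Theorems.LocalSineTubeDoorProfileAlignedWindowRigidityAncient
open Summit.NavierStokesRegularity.NavierStokesRegularity.Theorems.PoloidalWindowDoorLrcModEntireThreadPins

/-! ## Translation of a class profile to a hot point -/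

/-- **The translate `v(·, · + y)` of a class profile is a class profile with the same constant** (rate, continuity, mild identity — translation
covariance of the heat flow and of the Duhamel term). [folklore] -/
theorem class_translate {C : ℝ} {v : ℝ → EuclideanSpace ℝ (Fin 3) → EuclideanSpace ℝ (Fin 3)}
    (hrate : HasTypeITimeDecay C v) (hcont : ContinuousOn (uncurry v) (Iio (0 : ℝ) ×ˢ univ))
    (hmild : ∀ s t : ℝ, s < t → t < 0 → ∀ x, v t x = heatExtension (v s) (t - s) x - oseenDuhamel 1 s v v t x)
    (y : EuclideanSpace ℝ (Fin 3)) :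
    HasTypeITimeDecay C (fun t x => v t (x + y)) ∧
      ContinuousOn (uncurry fun t x => v t (x + y)) (Iio (0 : ℝ) ×ˢ univ) ∧
      (∀ s t : ℝ, s < t → t < 0 → ∀ x, (fun t x => v t (x + y)) t x =
        heatExtension ((fun t x => v t (x + y)) s) (t - s) x -
          oseenDuhamel 1 s (fun t x => v t (x + y)) (fun t x => v t (x + y)) t x) := by
  refine ⟨fun t ht x => hrate t ht (x + y), ?_, ?_⟩
  · have hφ : Continuous fun p : ℝ × EuclideanSpace ℝ (Fin 3) => (p.1, p.2 + y) := by fun_prop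
    have hmaps : MapsTo (fun p : ℝ × EuclideanSpace ℝ (Fin 3) => (p.1, p.2 + y)) (Iio (0 : ℝ) ×ˢ univ) (Iio (0 : ℝ) ×ˢ univ) :=
      fun p hp => ⟨(mem_prod.1 hp).1, mem_univ _⟩
    exact hcont.comp hφ.continuousOn hmaps
  · intro s t hst ht x
    show v t (x + y) = heatExtension (fun x => v s (x + y)) (t - s) x -
      oseenDuhamel 1 s (fun τ x => v τ (x + y)) (fun τ x => v τ (x + y)) t x
    rw [heatExtension_comp_add_right, oseenDuhamel_comp_add_right]
    exact hmild s t hst ht (x + y)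

/-! ## R10 — the time pin on the whole hot set -/

/-- **R10 `HotTimePin` (VERBATIM, `Pinned`/`hotSet` unfolded): `∂ₜv₂(−1,y) = N/2` at every hot point `y`** — `…ThreadPins.threadTimePin` for the translate
`v(·, · + y)`, whose hot spot is `0`. -/
theorem hotTimePin :
    ∀ (C : ℝ) (v : ℝ → EuclideanSpace ℝ (Fin 3) → EuclideanSpace ℝ (Fin 3)),
      (Literature.Analysis.FluidPDE.HasTypeITimeDecay C v ∧
        ContinuousOn (Function.uncurry v) (Set.Iio (0 : ℝ) ×ˢ Set.univ) ∧
        (∀ s t : ℝ, s < t → t < 0 → ∀ x, v t x =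
          Literature.Analysis.UnboundedOperators.heatExtension (v s) (t - s) x -
            Literature.Analysis.FluidPDE.oseenDuhamel 1 s v v t x) ∧
        (∀ t < 0, Literature.Analysis.FluidPDE.VectorCalculus.IsDivFree (v t)) ∧
        (∀ s < 0, ∀ y, ⟪Literature.Analysis.FluidPDE.curl (v s) y, EuclideanSpace.single 2 1⟫_ℝ = 0) ∧
        v (-1) 0 2 ≠ 0 ∧ (∀ t < 0, ∀ x, Real.sqrt (-t) * |v t x 2| ≤ |v (-1) 0 2|) ∧
        (∀ h : EuclideanSpace ℝ (Fin 3), fderiv ℝ (v (-1)) 0 h 2 = 0) ∧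
        (deriv (fun s => v s 0 2) (-1) = v (-1) 0 2 / 2 ∧ v (-1) 0 2 * (Δ (fun y => v (-1) y 2)) 0 ≤ 0)) →
      ∀ y ∈ {y : EuclideanSpace ℝ (Fin 3) | y 2 = 0 ∧ v (-1) y 2 = v (-1) 0 2}, deriv (fun s => v s y 2) (-1) = v (-1) 0 2 / 2 := by
  intro C v hP y hy
  obtain ⟨hrate, hcont, hmild, -, -, hN, hsup, -, -⟩ := hP
  obtain ⟨-, hyN⟩ := hy
  obtain ⟨hrate', hcont', hmild'⟩ := class_translate hrate hcont hmild y
  have hne' : (fun t x => v t (x + y)) (-1) 0 2 ≠ 0 := by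
    show v (-1) (0 + y) 2 ≠ 0
    rw [zero_add, hyN]; exact hN
  have hhot' : ∀ t < 0, ∀ x, Real.sqrt (-t) * |(fun t x => v t (x + y)) t x 2| ≤ |(fun t x => v t (x + y)) (-1) 0 2| := by
    intro t ht x
    show Real.sqrt (-t) * |v t (x + y) 2| ≤ |v (-1) (0 + y) 2|
    rw [zero_add, hyN]; exact hsup t ht (x + y)
  have h := threadTimePin hrate' hcont' hmild' hne' hhot'
  have e1 : (fun s => (fun t x => v t (x + y)) s 0 2) = fun s => v s y 2 := funext fun s => by
    show v s (0 + y) 2 = v s y 2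
    rw [zero_add]
  rw [e1] at h
  rw [h]
  show v (-1) (0 + y) 2 / 2 = v (-1) 0 2 / 2
  rw [zero_add, hyN]

/-! ## R9 — the horizontal Laplace sign on the whole hot set -/

/-- **Pure second derivatives of `σ·v₂(−1,·)` are `≤ 0` at a global extremum** (1-D second-derivative test along every line;
`…ThreadPins.deriv2_nonpos_of_isLocalMax`, `deriv2_line_eq_iteratedFDeriv`). [folklore] -/
theorem mul_iteratedFDeriv_two_nonpos {f : EuclideanSpace ℝ (Fin 3) → ℝ} (hf : ContDiff ℝ 2 f) {y : EuclideanSpace ℝ (Fin 3)}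
    (hmax : ∀ x, |f x| ≤ |f y|) (a : EuclideanSpace ℝ (Fin 3)) :
    f y * iteratedFDeriv ℝ 2 f y ![a, a] ≤ 0 := by
  by_cases hfy : f y = 0
  · rw [hfy, zero_mul]
  obtain ⟨σ, hσabs, hσa⟩ : ∃ σ : ℝ, |σ| = 1 ∧ σ * f y = |f y| := by
    rcases lt_or_gt_of_ne hfy with h | h
    · exact ⟨-1, by simp, by rw [abs_of_neg h]; ring⟩
    · exact ⟨1, by simp, by rw [abs_of_pos h]; ring⟩
  have hσle : ∀ r : ℝ, σ * r ≤ |r| := fun r =>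
    calc σ * r ≤ |σ * r| := le_abs_self _
      _ = |r| := by rw [abs_mul, hσabs, one_mul]
  have hσ2 : σ * σ = 1 := by
    have h := congrArg (fun r : ℝ => r ^ 2) hσabs
    simp only [sq_abs, one_pow] at h
    nlinarith [h]
  have hφc : ContDiff ℝ 2 (fun t : ℝ => σ * f (y + t • a)) :=
    contDiff_const.mul (hf.comp (contDiff_const.add (contDiff_id.smul contDiff_const)))
  have hloc : IsLocalMax (fun t : ℝ => σ * f (y + t • a)) 0 := by
    refine Filter.Eventually.of_forall fun t => ?_
    show σ * f (y + t • a) ≤ σ * f (y + (0 : ℝ) • a)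
    simp only [zero_smul, add_zero]
    calc σ * f (y + t • a) ≤ |f (y + t • a)| := hσle _
      _ ≤ |f y| := hmax _
      _ = σ * f y := hσa.symm
  have hA := deriv2_nonpos_of_isLocalMax hφc hloc
  have hB : deriv (deriv (fun t : ℝ => σ * f (y + t • a))) 0 = σ * iteratedFDeriv ℝ 2 f y ![a, a] := by
    rw [← deriv2_line_eq_iteratedFDeriv hf y a]
    have e1 : deriv (fun t : ℝ => σ * f (y + t • a)) = fun t => σ * deriv (fun t : ℝ => f (y + t • a)) t :=
      deriv_const_mul_field' σ
    rw [e1, deriv_const_mul_field']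
  rw [hB] at hA
  have hfy' : f y = |f y| * σ := by
    calc f y = (σ * σ) * f y := by rw [hσ2, one_mul]
      _ = (σ * f y) * σ := by ring
      _ = |f y| * σ := by rw [hσa]
  rw [hfy', mul_assoc]
  exact mul_nonpos_of_nonneg_of_nonpos (abs_nonneg _) hA

/-- **R9 `HotLapSign` (VERBATIM, `Pinned`/`hotSet`/`lapH`/`hess` unfolded): `N·Δₕv₂(−1,y) ≤ 0` at every hot point `y`**, the horizontal Laplacian in the
column's nested-`fderiv` convention. -/
theorem hotLapSign :
    ∀ (C : ℝ) (v : ℝ → EuclideanSpace ℝ (Fin 3) → EuclideanSpace ℝ (Fin 3)),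
      (Literature.Analysis.FluidPDE.HasTypeITimeDecay C v ∧
        ContinuousOn (Function.uncurry v) (Set.Iio (0 : ℝ) ×ˢ Set.univ) ∧
        (∀ s t : ℝ, s < t → t < 0 → ∀ x, v t x =
          Literature.Analysis.UnboundedOperators.heatExtension (v s) (t - s) x -
            Literature.Analysis.FluidPDE.oseenDuhamel 1 s v v t x) ∧
        (∀ t < 0, Literature.Analysis.FluidPDE.VectorCalculus.IsDivFree (v t)) ∧
        (∀ s < 0, ∀ y, ⟪Literature.Analysis.FluidPDE.curl (v s) y, EuclideanSpace.single 2 1⟫_ℝ = 0) ∧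
        v (-1) 0 2 ≠ 0 ∧ (∀ t < 0, ∀ x, Real.sqrt (-t) * |v t x 2| ≤ |v (-1) 0 2|) ∧
        (∀ h : EuclideanSpace ℝ (Fin 3), fderiv ℝ (v (-1)) 0 h 2 = 0) ∧
        (deriv (fun s => v s 0 2) (-1) = v (-1) 0 2 / 2 ∧ v (-1) 0 2 * (Δ (fun y => v (-1) y 2)) 0 ≤ 0)) →
      ∀ y ∈ {y : EuclideanSpace ℝ (Fin 3) | y 2 = 0 ∧ v (-1) y 2 = v (-1) 0 2},
        v (-1) 0 2 *
          (fderiv ℝ (fun x => fderiv ℝ (fun x' => v (-1) x' 2) x (EuclideanSpace.single 0 1)) y (EuclideanSpace.single 0 1) +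
            fderiv ℝ (fun x => fderiv ℝ (fun x' => v (-1) x' 2) x (EuclideanSpace.single 1 1)) y (EuclideanSpace.single 1 1)) ≤ 0 := by
  intro C v hP y hy
  obtain ⟨hrate, hcont, hmild, -, -, -, hsup, -, -⟩ := hP
  obtain ⟨-, hyN⟩ := hy
  set f : EuclideanSpace ℝ (Fin 3) → ℝ := fun x => v (-1) x 2 with hf
  have hfa : ContDiff ℝ 2 f := by
    have hsl := analyticOnNhd_slice hcont (bdd_of_hasTypeITimeDecay hrate) hmild (by norm_num : (-1 : ℝ) < 0)
    have han : AnalyticOnNhd ℝ f univ := fun x _ =>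
      ((EuclideanSpace.proj (𝕜 := ℝ) (2 : Fin 3)).analyticAt _).comp (hsl x (mem_univ _))
    exact han.contDiff
  have hmax : ∀ x, |f x| ≤ |f y| := fun x => by
    have h := hsup (-1) (by norm_num) x
    have hR : Real.sqrt (-(-1 : ℝ)) = 1 := by norm_num
    rw [hR, one_mul] at h
    show |v (-1) x 2| ≤ |v (-1) y 2|
    rw [hyN]; exact h
  have h0 := mul_iteratedFDeriv_two_nonpos hfa hmax (EuclideanSpace.single 0 1)
  have h1 := mul_iteratedFDeriv_two_nonpos hfa hmax (EuclideanSpace.single 1 1)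
  have e0 : fderiv ℝ (fun x => fderiv ℝ f x (EuclideanSpace.single 0 1)) y (EuclideanSpace.single 0 1) =
      iteratedFDeriv ℝ 2 f y ![EuclideanSpace.single 0 1, EuclideanSpace.single 0 1] :=
    Literature.Analysis.FluidPDE.fderiv_fderiv_apply_eq_iteratedFDeriv hfa y _ _
  have e1 : fderiv ℝ (fun x => fderiv ℝ f x (EuclideanSpace.single 1 1)) y (EuclideanSpace.single 1 1) =
      iteratedFDeriv ℝ 2 f y ![EuclideanSpace.single 1 1, EuclideanSpace.single 1 1] :=
    Literature.Analysis.FluidPDE.fderiv_fderiv_apply_eq_iteratedFDeriv hfa y _ _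
  have hfy : f y = v (-1) 0 2 := hyN
  show v (-1) 0 2 * (fderiv ℝ (fun x => fderiv ℝ f x (EuclideanSpace.single 0 1)) y (EuclideanSpace.single 0 1) +
      fderiv ℝ (fun x => fderiv ℝ f x (EuclideanSpace.single 1 1)) y (EuclideanSpace.single 1 1)) ≤ 0
  rw [e0, e1, ← hfy, mul_add]
  exact add_nonpos h0 h1

end Summit.NavierStokesRegularity.NavierStokesRegularity.Theorems.PoloidalWindowDoorPoloidalWindowRigidityLeafUniformPins

end
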